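import Summits.BirchSwinnertonDyer.BirchSwinnertonDyer.Theorems.SignedLowerHalvesSprungLowerDivisibilityAtThreeSqueezeToCommonZeros
import Summits.BirchSwinnertonDyer.BirchSwinnertonDyer.Theorems.SignedLowerHalvesSprungLowerDivisibilityAtThreeStubPeriodMu
import Summits.BirchSwinnertonDyer.BirchSwinnertonDyer.Theorems.SignedLowerHalvesSprungLowerDivisibilityAtThreeColourTransfer
import Summits.BirchSwinnertonDyer.BirchSwinnertonDyer.Theses.SignedLowerHalves
import Literature.NumberTheory.EllipticCurves.Sprung2012.SharpFlatColemanKatoZetaJoint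
import Literature.NumberTheory.EllipticCurves.Sprung2017.SharpFlatNonvanishingProofs
import Literature.NumberTheory.EllipticCurves.SkinnerUrban2014.CharacteristicIdealBaseChangeProofs
import HarnessLib

/-!
# Crux `SprungLowerDivisibilityAtThree` (item stmt-BirchSwinnertonDyer-19875), line `chromatic-common-zeros`:
# ON CLASS X8, K1 (both colours) IS EXACTLY THE EISENSTEIN HALF OF KATO'S MAIN CONJECTURE 12.10, prime by prime

Cell `bsd-ssimc` (host) / lead `cruxlead-stmt-BirchSwinnertonDyer-19875` (g2); `--supports` 19875 `--as helper`; theorems only; closes NO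
item; K1 / BSD / leaf X8 are NOT proved by anything here.

WHAT. For an X8 pair `(W, 3)` put `KFL(W)` := «in the setting of Sprung 2012 Thm. 2.2 (cyclotomic `(κ, γ)`, place `v ∣ 3`, local lift `g`,
Honda system), for every newform `f`, period ratio `ϖ`, Sprung pair `(L♯, L♭)`, every pinned `I = 𝐇¹_Γ(T_3W)` with JOINT ♯/♭ Coleman–Kato
packages `Cs, Cf` (`Cs.Z = Cf.Z`), every fine dual datum `Y` and every height-one prime `𝔭` of `Λ = ℤ₃⟦T⟧`:
`ℓ_𝔭(I.H ⧸ Cs.Z) ≤ ℓ_𝔭 Y.X`» — the Eisenstein («`X₀` is at least as long as the zeta index») half of Kato 2004 Conj. 12.10 for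
`T_3E`, read at every height-one prime, in the tree's pinned currency. THEN, modulo the named facts `h714` (Sprung 2012 Thm. 7.14) and
`h3` (period unit at 3) [and W-β `hJ` for (⟸)]:

* (⟹) `katoFineLower_of_lowerDivisibility`: `(∀ •, SprungSharpFlatLowerDivisibility W 3 •) → KFL(W)` — at each `𝔭` pick a colour `∘`
  with `L^∘ ≠ 0` (Sprung 2012 Prop. 6.14, tree THEOREM `IsSprungPair.ne_zero_or_ne_zero`, Rohrlich), a real dual datum `D` of `Sel^∘`
  (f.g. torsion by Thm. 7.14), read K1's conclusion `char X^∘ = (G^∘·h)` as the local inequality `ℓ_𝔭 Λ/(G^∘) ≤ ℓ_𝔭 X^∘`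
  (`lengthAt_le_of_charIdeal_le`, Skinner–Urban §3.1.6) and convert by the four-term identity (`eisenstein_iff_fine`, p607724);
* (⟸) `lowerDivisibility_of_katoFineLower`: `KFL(W) → ∀ •, SprungSharpFlatLowerDivisibility W 3 •` — the v7 glue with BOTH open stubs
  replaced by `KFL` at every prime (S1 `stub_squeezeToCommonZeros` + `eisenstein_iff_fine`; no S3, no S4 needed);
* `sprungLowerDivisibility_iff_katoFineLower`: the equivalence, per X8 pair.

CONSEQUENCES (documentation; nothing closes): (i) the crux K1 — for one colour or for both — is neither weaker nor stronger than Kato's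
lower bound for X8 curves; the chromatic language adds nothing to and removes nothing from its difficulty («OPEN IN PRINT at a₃ = ±3»);
(ii) the line's landed pieces are PARTIAL RESULTS on Kato's lower bound for X8: it holds at `𝔭 = (3)` (S3, THEOREM B: in fact
`μ(𝐇¹/Z) = 0`) and at `𝔭 = (T)` when `r_an ≤ 1` (S4a: GZK + control + Kobayashi–Sprung simple zero); (iii) the registered v7 stubs
K_spor / S4b are `KFL` restricted to the sporadic resp. remaining cyclotomic common zeros.

References: [Kato2004Asterisque] Conj. 12.10 (p. 224), Thm. 12.5/12.6 (p. 222), §17.13 (p. 280); [Sprung2012] Prop. 6.14 (p. 1498), Thm. 7.14 (3)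
(p. 1504), Prop. 7.19, Main Conj. 7.21 (p. 1505); [SkinnerUrban2014] §3.1.6; [Washington1997] §13.2; tree `…SqueezeToCommonZeros` (p606891),
`…ColourTransfer` (p607724), `…StubPeriodMu` (p606253), `Sprung2017/SharpFlatNonvanishingProofs`, `SkinnerUrban2014/CharacteristicIdealBaseChangeProofs`.
-/

set_option linter.dupNamespace false
set_option autoImplicit false

noncomputable section

open scoped Classical NumberField MatrixGroups ModularForm

open NumberField IsDedekindDomain CongruenceSubgroup WeierstrassCurve Field
  Literature.NumberTheory.EllipticCurves Literature.NumberTheory.EllipticCurves.ModularForms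
  Literature.NumberTheory.EllipticCurves.ZpExtension Literature.NumberTheory.EllipticCurves.Sprung2017
  Literature.NumberTheory.EllipticCurves.Sprung2012 Literature.NumberTheory.EllipticCurves.Rank1Residual
  Literature.NumberTheory.EllipticCurves.IwasawaAlgebra Literature.NumberTheory.EllipticCurves.Kato2004
  Literature.NumberTheory.EllipticCurves.Module
  Summit.BirchSwinnertonDyer.BirchSwinnertonDyer.Theorems
  Summit.BirchSwinnertonDyer.BirchSwinnertonDyer.Theorems.SmallImageSignedMuDefect
  Summit.BirchSwinnertonDyer.Rank1Residual.Supersingular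

namespace Summit.BirchSwinnertonDyer.BirchSwinnertonDyer.Theorems.ChromaticCommonZeros

/-! ### §1 K1's conclusion, read prime by prime -/

/-- **`char X = (G·h)` with `G ≠ 0` ⟹ `ℓ_𝔭 Λ/(G) ≤ ℓ_𝔭 X` at every height-one prime** (finitely generated torsion `X` over `Λ = ℤ_p⟦T⟧`;
the Néron normalisation `ι gen = C(ϖ)·ι(L·h)`, `ι G = C(ϖ)·ι L` gives `gen = G·h`): `char X = (G h) ⊆ (G) = char Λ/(G)` and the
characteristic ideal determines the height-one lengths (Skinner–Urban §3.1.6). [cite: SkinnerUrban2014, §3.1.6 (p. 20)]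
[cite: Washington1997, §13.2] -/
theorem lengthAt_quotient_le_of_charIdeal_eq_span {p : ℕ} [Fact p.Prime] {ϖ : ℚ} {L G gen h : IwasawaAlgebra p}
    {X : Type*} [AddCommGroup X] [Module (IwasawaAlgebra p) X] [Module.Finite (IwasawaAlgebra p) X]
    (hXt : Module.IsTorsion (IwasawaAlgebra p) X)
    (hG : iwasawaToPowerSeries p G = PowerSeries.C (ϖ : ℚ_[p]) * iwasawaToPowerSeries p L) (hG0 : G ≠ 0)
    (hchar : Module.charIdeal (IwasawaAlgebra p) X = Ideal.span {gen})
    (hgen : iwasawaToPowerSeries p gen = PowerSeries.C (ϖ : ℚ_[p]) * iwasawaToPowerSeries p (L * h))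
    (𝔭 : PrimeSpectrum (IwasawaAlgebra p)) (h𝔭 : 𝔭.asIdeal.height = 1) :
    Module.lengthAt (IwasawaAlgebra p) (IwasawaAlgebra p ⧸ Ideal.span {G}) 𝔭 ≤
      Module.lengthAt (IwasawaAlgebra p) X 𝔭 := by
  -- `gen = G · h`
  have hgen' : gen = G * h :=
    iwasawaToPowerSeries_injective p (by rw [hgen, map_mul, map_mul, hG, mul_assoc])
  -- `Λ/(G)` is torsion with `char = (G)`
  have hby : Module.IsTorsionBy (IwasawaAlgebra p) (IwasawaAlgebra p ⧸ Ideal.span {G}) G :=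
    (Module.isTorsionBy_quotient_iff _ G).mpr fun y ↦ by
      rw [smul_eq_mul]
      exact Ideal.mul_mem_right y _ (Ideal.mem_span_singleton_self G)
  have htor : Module.IsTorsion (IwasawaAlgebra p) (IwasawaAlgebra p ⧸ Ideal.span {G}) :=
    fun x ↦ ⟨⟨G, mem_nonZeroDivisors_of_ne_zero hG0⟩, @hby x⟩
  have hcharQ : Module.charIdeal (IwasawaAlgebra p) (IwasawaAlgebra p ⧸ Ideal.span {G}) = Ideal.span {G} :=
    Module.charIdeal_eq_span_of_lengthAt_eq_quotient hG0 fun _ _ ↦ rfl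
  -- `char X = (G h) ⊆ (G) = char Λ/(G)`
  have hle : Module.charIdeal (IwasawaAlgebra p) X ≤ Module.charIdeal (IwasawaAlgebra p) (IwasawaAlgebra p ⧸ Ideal.span {G}) := by
    rw [hchar, hcharQ, hgen', Ideal.span_singleton_le_span_singleton]
    exact dvd_mul_right G h
  exact SkinnerUrban2014.lengthAt_le_of_charIdeal_le hXt htor hle 𝔭 h𝔭

/-! ### §2 (⟹) K1 for both colours gives Kato's fine lower bound at every height-one prime -/

/-- **K1 (both colours) ⟹ `KFL`, per X8 pair.** In the setting of Sprung 2012 Thm. 2.2 on an X8 pair, for every newform, period ratio,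
Sprung pair, every pinned `I` with joint packages `Cs, Cf` (`Cs.Z = Cf.Z`), every fine dual `Y` and every height-one `𝔭`:
`ℓ_𝔭(I.H ⧸ Cs.Z) ≤ ℓ_𝔭 Y.X`. Proof: some colour `∘` has `L^∘ ≠ 0` (Prop. 6.14, Rohrlich); its normalised `G^∘` exists (period unit);
a real dual datum `D` of `Sel^∘` is f.g. torsion (Thm. 7.14); K1 for `∘` gives `char X^∘ = (G^∘ h)`, whence `ℓ_𝔭 Λ/(G^∘) ≤ ℓ_𝔭 X^∘`
(§1), whence the fine inequality (`eisenstein_iff_fine`). CONDITIONAL on `h714`, `h3` (displayed).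
[cite: Kato2004Asterisque, Conj. 12.10 (p. 224)] [cite: Sprung2012, Prop. 6.14 (p. 1498), Thm. 7.14 (p. 1504), Prop. 7.19 (p. 1505)] -/
theorem katoFineLower_of_lowerDivisibility (h714 : thm714_sharpFlatSelmerDual_finite_torsion)
    (h3 : realPeriodRat_eq_unit_mul_plusPeriod_three)
    (W : WeierstrassCurve ℚ) [W.IsElliptic] [W.IsGloballyMinimal] (p : ℕ) [Fact p.Prime]
    [ContinuousSMul ℤ_[p] (W.tateModule p)] [Module.Free ℤ_[p] (W.tateModule p)]
    [Module.Finite ℤ_[p] (W.tateModule p)]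
    (hX : ClassX8 W p) (hK1 : ∀ col : Chroma, SprungSharpFlatLowerDivisibility W p col)
    (κ : ZpExtension ℚ p) (γ : Field.absoluteGaloisGroup ℚ)
    (hκ : κ.IsCyclotomic) (hγ : κ.IsTopGenerator γ) (hcv : IsCyclotomicVariable p γ)
    (v : HeightOneSpectrum (𝓞 ℚ)) (hv : (p : 𝓞 ℚ) ∈ v.asIdeal)
    (g : Field.absoluteGaloisGroup (v.adicCompletion ℚ))
    (hg : κ.IsTopGenerator (resGalOfEmb (closureEmb (K := ℚ) (v.adicCompletion ℚ)) g))
    (cneg : localPoints W (v.adicCompletion ℚ)) (c : ℕ → localPoints W (v.adicCompletion ℚ))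
    (hH : IsHondaSystem κ (closureEmb (K := ℚ) (v.adicCompletion ℚ)) W (W.frobeniusTrace p) g cneg c)
    (N : ℕ) (hN : NeZero N) (f : CuspForm (Gamma0 N) 2) (ϖ : ℚ) (Lsharp Lflat : IwasawaAlgebra p)
    (hf : IsNewformOf W f) (hϖ : (ϖ : ℝ) * W.realPeriodRat = plusPeriod f)
    (hSP : IsSprungPair f p (W.frobeniusTrace p) Lsharp Lflat)
    (I : Kato2004.IwasawaH1Data W p κ γ)
    (Cs : SharpFlatColemanKatoData W p f ϖ κ γ (closureEmb (K := ℚ) (v.adicCompletion ℚ)) (W.frobeniusTrace p) g c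
      Chroma.sharp I)
    (Cf : SharpFlatColemanKatoData W p f ϖ κ γ (closureEmb (K := ℚ) (v.adicCompletion ℚ)) (W.frobeniusTrace p) g c
      Chroma.flat I)
    (hZ : Cs.Z = Cf.Z) (Y : W.FineSelmerDualData κ γ)
    (𝔭 : PrimeSpectrum (IwasawaAlgebra p)) (h𝔭 : 𝔭.asIdeal.height = 1) :
    Module.lengthAt (IwasawaAlgebra p) (I.H ⧸ Cs.Z) 𝔭 ≤ Module.lengthAt (IwasawaAlgebra p) Y.X 𝔭 := by
  classical
  haveI : NeZero N := hN
  obtain ⟨hp3, ⟨hgood, hap⟩, -⟩ := id hX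
  subst hp3
  have hp2 : (3 : ℕ) ≠ 2 := by decide
  have hirr : W.HasIrreducibleModPGaloisRep 3 :=
    hasIrreducibleModPGaloisRep_of_dvd_frobeniusTrace W 3 hp2
      (W.not_dvd_minimalDiscriminantInt_of_hasGoodReductionAtPrime' 3 hgood) hap
  have hϖ0 : ϖ ≠ 0 := hf.periodRatio_ne_zero hϖ
  obtain ⟨hGall, -⟩ := stub_periodMu h3 W 3 hX N hN f ϖ Lsharp Lflat hf hϖ hSP
  -- the local Eisenstein inequality for ANY non-zero colour `∘`, for ANY dual datum of that colour
  have key : ∀ (c₀ : Chroma), chromaticL c₀ Lsharp Lflat ≠ 0 →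
      ∀ (C : SharpFlatColemanKatoData W 3 f ϖ κ γ (closureEmb (K := ℚ) (v.adicCompletion ℚ))
        (W.frobeniusTrace 3) g c c₀ I),
      Module.lengthAt (IwasawaAlgebra 3) (I.H ⧸ C.Z) 𝔭 ≤ Module.lengthAt (IwasawaAlgebra 3) Y.X 𝔭 := by
    intro c₀ hc₀ C
    obtain ⟨G, hG⟩ := hGall c₀
    have hG0 : G ≠ 0 := by
      intro h0
      rw [h0, map_zero, eq_comm, mul_eq_zero] at hG
      rcases hG with hC | hL
      · have h1 : ((ϖ : ℚ) : ℚ_[3]) = 0 := by simpa using congrArg PowerSeries.constantCoeff hC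
        exact hϖ0 (by exact_mod_cast h1)
      · exact hc₀ (iwasawaToPowerSeries_injective 3 (by rw [hL, map_zero]))
    obtain ⟨D⟩ := nonempty_sharpFlatSelmerDualData_rat W κ γ v g c c₀
    obtain ⟨hfin, hXt⟩ := h714 W 3 hp2 hgood hap f hf κ γ hκ hγ hcv v hv g hg cneg c hH c₀ Lsharp Lflat hSP hc₀ D
    haveI := hfin
    obtain ⟨gen, h, hchar, hgen⟩ :=
      hK1 c₀ κ γ hκ hγ hcv v hv g hg cneg c hH N hN f ϖ Lsharp Lflat hf hϖ hSP hc₀ D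
    have hloc := lengthAt_quotient_le_of_charIdeal_eq_span hXt hG hG0 hchar hgen 𝔭 h𝔭
    exact (C.eisenstein_iff_fine W 3 hirr hSP hc₀ hG hG0 D hXt Y 𝔭 h𝔭).mp hloc
  rcases IsSprungPair.ne_zero_or_ne_zero hf hgood hSP with hs | hfl
  · exact key Chroma.sharp hs Cs
  · rw [hZ]; exact key Chroma.flat hfl Cf

/-! ### §3 (⟸) Kato's fine lower bound at every height-one prime gives K1 for both colours -/

/-- **`KFL` ⟹ K1, per X8 pair and colour.** If for every admissible datum of the pair the fine inequality `ℓ_𝔭(I.H ⧸ Cs.Z) ≤ ℓ_𝔭 Y.X`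
holds at EVERY height-one `𝔭` (hypothesis `hKFL`, the shape of §2's conclusion), then `SprungSharpFlatLowerDivisibility W p •` for
every colour `•`: S1 (`stub_squeezeToCommonZeros`, p606891) + the four-term identity (`eisenstein_iff_fine`) at each common zero.
CONDITIONAL on `h714`, `h3`, `hJ` (W-β: the joint package exists). [cite: Kato2004Asterisque, Conj. 12.10 (p. 224)]
[cite: Sprung2012, Thm. 7.14 (3) (p. 1504), Prop. 7.19 and Main Conj. 7.21 (p. 1505)] -/
theorem lowerDivisibility_of_katoFineLower (h714 : thm714_sharpFlatSelmerDual_finite_torsion)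
    (h3 : realPeriodRat_eq_unit_mul_plusPeriod_three) (hJ : thm714seq_sharpFlatColemanKato_zetaJoint)
    (W : WeierstrassCurve ℚ) [W.IsElliptic] [W.IsGloballyMinimal] (p : ℕ) [Fact p.Prime]
    [ContinuousSMul ℤ_[p] (W.tateModule p)] [Module.Free ℤ_[p] (W.tateModule p)]
    [Module.Finite ℤ_[p] (W.tateModule p)] (hX : ClassX8 W p)
    (hKFL :
      ∀ (κ : ZpExtension ℚ p) (γ : Field.absoluteGaloisGroup ℚ),
        κ.IsCyclotomic → κ.IsTopGenerator γ → IsCyclotomicVariable p γ →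
      ∀ (v : HeightOneSpectrum (𝓞 ℚ)), (p : 𝓞 ℚ) ∈ v.asIdeal →
      ∀ (g : Field.absoluteGaloisGroup (v.adicCompletion ℚ)),
        κ.IsTopGenerator (resGalOfEmb (closureEmb (K := ℚ) (v.adicCompletion ℚ)) g) →
      ∀ (cneg : localPoints W (v.adicCompletion ℚ)) (c : ℕ → localPoints W (v.adicCompletion ℚ)),
        IsHondaSystem κ (closureEmb (K := ℚ) (v.adicCompletion ℚ)) W (W.frobeniusTrace p) g cneg c →
      ∀ (N : ℕ) (_ : NeZero N) (f : CuspForm (Gamma0 N) 2) (ϖ : ℚ) (Lsharp Lflat : IwasawaAlgebra p),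
        IsNewformOf W f → (ϖ : ℝ) * W.realPeriodRat = plusPeriod f →
        IsSprungPair f p (W.frobeniusTrace p) Lsharp Lflat →
      ∀ (I : Kato2004.IwasawaH1Data W p κ γ)
        (Cs : SharpFlatColemanKatoData W p f ϖ κ γ (closureEmb (K := ℚ) (v.adicCompletion ℚ))
          (W.frobeniusTrace p) g c Chroma.sharp I)
        (Cf : SharpFlatColemanKatoData W p f ϖ κ γ (closureEmb (K := ℚ) (v.adicCompletion ℚ))
          (W.frobeniusTrace p) g c Chroma.flat I),
        Cs.Z = Cf.Z →
      ∀ (Y : W.FineSelmerDualData κ γ) (𝔭 : PrimeSpectrum (IwasawaAlgebra p)), 𝔭.asIdeal.height = 1 →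
        Module.lengthAt (IwasawaAlgebra p) (I.H ⧸ Cs.Z) 𝔭 ≤ Module.lengthAt (IwasawaAlgebra p) Y.X 𝔭)
    (col : Chroma) : SprungSharpFlatLowerDivisibility W p col := by
  classical
  obtain ⟨hp3, ⟨hgood, hap⟩, -⟩ := id hX
  subst hp3
  intro κ γ hκ hγ hcv v hv g hg cneg c hH N hN f ϖ Lsharp Lflat hf hϖ hSP hcol D
  haveI : NeZero N := hN
  have hp2 : (3 : ℕ) ≠ 2 := by decide
  have hirr : W.HasIrreducibleModPGaloisRep 3 :=
    hasIrreducibleModPGaloisRep_of_dvd_frobeniusTrace W 3 hp2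
      (W.not_dvd_minimalDiscriminantInt_of_hasGoodReductionAtPrime' 3 hgood) hap
  haveI : Module.Finite (IwasawaAlgebra 3) D.X :=
    h714.moduleFinite hp2 hgood hap hf hκ hγ hcv hv hg hH hSP hcol D
  have hXt : Module.IsTorsion (IwasawaAlgebra 3) D.X :=
    h714.isTorsion hp2 hgood hap hf hκ hγ hcv hv hg hH hSP hcol D
  obtain ⟨I⟩ := Kato2004.nonempty_iwasawaH1Data_holds W 3 κ γ hκ hγ
  obtain ⟨Cs, Cf, hZ⟩ := hJ W 3 f ϖ κ γ hp2 hgood hap hf hϖ hκ hγ hcv v hv g hg cneg c hH I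
  obtain ⟨Y⟩ := W.nonempty_fineSelmerDualData κ hγ
  obtain ⟨hGall, -⟩ := stub_periodMu h3 W 3 hX N hN f ϖ Lsharp Lflat hf hϖ hSP
  obtain ⟨G, hGn⟩ := hGall col
  have hϖ0 : ϖ ≠ 0 := hf.periodRatio_ne_zero hϖ
  have hG0 : G ≠ 0 := by
    intro h0
    rw [h0, map_zero, eq_comm, mul_eq_zero] at hGn
    rcases hGn with hC | hL
    · have h1 : ((ϖ : ℚ) : ℚ_[3]) = 0 := by simpa using congrArg PowerSeries.constantCoeff hC
      exact hϖ0 (by exact_mod_cast h1)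
    · exact hcol (iwasawaToPowerSeries_injective 3 (by rw [hL, map_zero]))
  refine stub_squeezeToCommonZeros W 3 hX col κ γ hκ hγ hcv v hv g hg cneg c hH N hN f ϖ
    Lsharp Lflat hf hϖ hSP hcol D hXt G hGn I Cs Cf hZ ?_
  intro 𝔭 h𝔭 _
  have hK := hKFL κ γ hκ hγ hcv v hv g hg cneg c hH N hN f ϖ Lsharp Lflat hf hϖ hSP I Cs Cf hZ Y 𝔭 h𝔭
  cases col with
  | sharp => exact (Cs.eisenstein_iff_fine W 3 hirr hSP hcol hGn hG0 D hXt Y 𝔭 h𝔭).mpr hK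
  | flat =>
    rw [hZ] at hK
    exact (Cf.eisenstein_iff_fine W 3 hirr hSP hcol hGn hG0 D hXt Y 𝔭 h𝔭).mpr hK

/-! ### §4 The equivalence, per X8 pair -/

/-- **On class X8, K1 for both colours ⟺ Kato's fine lower bound at every height-one prime** (modulo Sprung 2012 Thm. 7.14, the period
unit at 3 and the joint Coleman–Kato package W-β): `(∀ •, SprungSharpFlatLowerDivisibility W p •) ↔ KFL(W)`. The Eisenstein half of
Sprung's ♯/♭ main conjecture on X8 — the crux K1 — is therefore exactly the Eisenstein half of Kato's Conj. 12.10 for these curves, read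
prime by prime; the line's S3 (at `(3)`) and S4a (at `(T)`, `r_an ≤ 1`) are partial results on the latter. Documentation theorem; closes nothing.
[cite: Kato2004Asterisque, Conj. 12.10 (p. 224), §17.13 (p. 280)] [cite: Sprung2012, Prop. 6.14 (p. 1498), Thm. 7.14 (p. 1504), Prop. 7.19 and Main Conj. 7.21 (p. 1505)] -/
theorem sprungLowerDivisibility_iff_katoFineLower (h714 : thm714_sharpFlatSelmerDual_finite_torsion)
    (h3 : realPeriodRat_eq_unit_mul_plusPeriod_three) (hJ : thm714seq_sharpFlatColemanKato_zetaJoint)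
    (W : WeierstrassCurve ℚ) [W.IsElliptic] [W.IsGloballyMinimal] (p : ℕ) [Fact p.Prime]
    [ContinuousSMul ℤ_[p] (W.tateModule p)] [Module.Free ℤ_[p] (W.tateModule p)]
    [Module.Finite ℤ_[p] (W.tateModule p)] (hX : ClassX8 W p) :
    (∀ col : Chroma, SprungSharpFlatLowerDivisibility W p col) ↔
      ∀ (κ : ZpExtension ℚ p) (γ : Field.absoluteGaloisGroup ℚ),
        κ.IsCyclotomic → κ.IsTopGenerator γ → IsCyclotomicVariable p γ →
      ∀ (v : HeightOneSpectrum (𝓞 ℚ)), (p : 𝓞 ℚ) ∈ v.asIdeal →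
      ∀ (g : Field.absoluteGaloisGroup (v.adicCompletion ℚ)),
        κ.IsTopGenerator (resGalOfEmb (closureEmb (K := ℚ) (v.adicCompletion ℚ)) g) →
      ∀ (cneg : localPoints W (v.adicCompletion ℚ)) (c : ℕ → localPoints W (v.adicCompletion ℚ)),
        IsHondaSystem κ (closureEmb (K := ℚ) (v.adicCompletion ℚ)) W (W.frobeniusTrace p) g cneg c →
      ∀ (N : ℕ) (_ : NeZero N) (f : CuspForm (Gamma0 N) 2) (ϖ : ℚ) (Lsharp Lflat : IwasawaAlgebra p),
        IsNewformOf W f → (ϖ : ℝ) * W.realPeriodRat = plusPeriod f →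
        IsSprungPair f p (W.frobeniusTrace p) Lsharp Lflat →
      ∀ (I : Kato2004.IwasawaH1Data W p κ γ)
        (Cs : SharpFlatColemanKatoData W p f ϖ κ γ (closureEmb (K := ℚ) (v.adicCompletion ℚ))
          (W.frobeniusTrace p) g c Chroma.sharp I)
        (Cf : SharpFlatColemanKatoData W p f ϖ κ γ (closureEmb (K := ℚ) (v.adicCompletion ℚ))
          (W.frobeniusTrace p) g c Chroma.flat I),
        Cs.Z = Cf.Z →
      ∀ (Y : W.FineSelmerDualData κ γ) (𝔭 : PrimeSpectrum (IwasawaAlgebra p)), 𝔭.asIdeal.height = 1 →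
        Module.lengthAt (IwasawaAlgebra p) (I.H ⧸ Cs.Z) 𝔭 ≤ Module.lengthAt (IwasawaAlgebra p) Y.X 𝔭 :=
  ⟨fun hK1 κ γ hκ hγ hcv v hv g hg cneg c hH N hN f ϖ Lsharp Lflat hf hϖ hSP I Cs Cf hZ Y 𝔭 h𝔭 =>
      katoFineLower_of_lowerDivisibility h714 h3 W p hX hK1 κ γ hκ hγ hcv v hv g hg cneg c hH N hN f ϖ Lsharp Lflat hf
        hϖ hSP I Cs Cf hZ Y 𝔭 h𝔭,
    fun hKFL col => lowerDivisibility_of_katoFineLower h714 h3 hJ W p hX hKFL col⟩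

end Summit.BirchSwinnertonDyer.BirchSwinnertonDyer.Theorems.ChromaticCommonZeros

end
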